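import Mathlib.Topology.Sets.Closeds
import Mathlib.Topology.ContinuousMap.Basic
import Mathlib.Topology.Separation.Regular
import Mathlib.Topology.Compactness.Compact
import HarnessLib

/-!
# The collapse `X/A` of a closed subspace to a point

For a topological space `X` and a closed subset `A` (`A : Closeds X`) we construct the pointed
space `X/A` in the convention of topological `K`-theory (Husemöller, *Fibre Bundles*, Ch. 10 §1
and (1.9): `X/∅ = X⁺`): the quotient of `X ⊔ {pt}` by the identification of `A` with `pt`. So the
base point `Collapse.pt` always exists, `X/∅` is `X` with a disjoint base point, and for
`A ≠ ∅` this is the usual quotient of `X` collapsing `A`.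

* `Collapse X A`, the quotient map `Collapse.mk : C(X, X/A)`, the base point `Collapse.pt`;
  `mk_eq_pt_iff`, `mk_eq_mk_iff`, `mk_injOn` (injective off `A`), `eq_pt_or_eq_mk`;
* the **universal property** `Collapse.lift f y hf : C(X/A, Y)` for `f` constant `= y` on `A`,
  `lift_mk`, `lift_pt`, `hom_ext`; functoriality `Collapse.map` for maps of pairs, `map_id`,
  `map_comp`;
* `CompactSpace (X/A)` for compact `X`, and **`T2Space (X/A)`** for `X` Hausdorff and regular
  (e.g. compact Hausdorff): `isOpen_image_mk` (images of open sets missing `A`),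
  `isOpen_insert_image_mk` (images of open neighbourhoods of `A` plus the base point).

Everything is proved; no named facts. Used by the exact sequence of a pair in `K`-theory
(`K(X, A) = K̃(X/A)`).

## References

* D. Husemöller, *Fibre Bundles*, 3rd ed., GTM 20, Springer (1994), Ch. 10 §1 (collapsing,
  `X/A`), Convention 1.9 (`X/∅ = X⁺ = X ∪ {*}`). [HusemollerFibreBundles1994]
* A. Hatcher, *Algebraic Topology*, CUP (2002), Ch. 0 p. 8 (quotient spaces `X/A`).
  [HatcherAT2002]

## Design notes

* The carrier is `Quotient (Setoid.ker (collapseKey A))` on `X ⊕ Unit`, where `collapseKey`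
  sends `A` and the extra point to `none` and `x ∉ A` to `some x`; this makes the relation an
  equivalence relation by construction and gives `X/∅ = X⁺` for free.
* `A` is bundled as `Closeds X` so that `T2Space (Collapse X A)` can be an instance.
* Mathlib has `OnePoint` (one-point compactification) and general `Quotient` topology but no
  `X/A`; the tree's `Literature.AlgebraicTopology.SingularHomology.OnePoint.collapse` is the
  collapse *map* onto `OnePoint` of an open subset (a different object, heavy imports). Nothing
  restated.
-/

noncomputable section

open Set Topology TopologicalSpace

namespace Literature.AlgebraicTopology.KTheory

universe u v

variable {X : Type u} [TopologicalSpace X]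

open scoped Classical in
/-- The key of a point of `X ⊔ {pt}` for the collapse of `A`: the points of `A` and the extra
point share the key `none`. [folklore] -/
def collapseKey (A : Closeds X) : X ⊕ Unit → Option X
  | Sum.inl x => if x ∈ A then none else some x
  | Sum.inr _ => none

/-- Keys of points of `A`. [folklore] -/
theorem collapseKey_inl_of_mem {A : Closeds X} {x : X} (hx : x ∈ A) : collapseKey A (Sum.inl x) = none := by
  simp [collapseKey, hx]

/-- Keys of points outside `A`. [folklore] -/
theorem collapseKey_inl_of_not_mem {A : Closeds X} {x : X} (hx : x ∉ A) : collapseKey A (Sum.inl x) = some x := by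
  simp [collapseKey, hx]

/-- Key of the extra point. [folklore] -/
@[simp] theorem collapseKey_inr {A : Closeds X} (z : Unit) : collapseKey A (Sum.inr z) = none := rfl

variable (X) in
/-- **The collapse `X/A`** of a closed subspace `A ⊆ X` to a point, realised as the quotient of
`X ⊔ {pt}` identifying `A` and `pt` (so that `X/∅ = X₊` is `X` with a disjoint base point and the
base point always exists), with the quotient topology. For compact Hausdorff `X` this is the
usual compact Hausdorff quotient space `X/A` of `K`-theory (Husemöller, *Fibre Bundles*, Ch. 10
§1, with the convention (1.9) `X/∅ = X⁺`). [folklore] -/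
def Collapse (A : Closeds X) : Type u := Quotient (Setoid.ker (collapseKey A))

namespace Collapse

variable {A : Closeds X}

/-- The quotient topology on `X/A`. -/
instance : TopologicalSpace (Collapse X A) := inferInstanceAs (TopologicalSpace (Quotient _))

variable (A) in
/-- The quotient map from `X ⊔ {pt}`. [folklore] -/
def mk' : X ⊕ Unit → Collapse X A := Quotient.mk _

/-- `mk'` is surjective. [folklore] -/
theorem mk'_surjective : Function.Surjective (mk' A) := Quotient.mk_surjective

/-- `mk'` is continuous. [folklore] -/
theorem continuous_mk' : Continuous (mk' A) := continuous_quotient_mk'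

/-- `mk'` is a quotient map. [folklore] -/
theorem isQuotientMap_mk' : IsQuotientMap (mk' A) := isQuotientMap_quotient_mk'

/-- Two points of `X ⊔ {pt}` have the same image iff they have the same key. [folklore] -/
theorem mk'_eq_mk'_iff {z w : X ⊕ Unit} : mk' A z = mk' A w ↔ collapseKey A z = collapseKey A w :=
  Quotient.eq (r := Setoid.ker (collapseKey A))

variable (A) in
/-- The collapse map `X → X/A`, continuous. [folklore] -/
def mk : C(X, Collapse X A) := ⟨fun x ↦ mk' A (Sum.inl x), continuous_mk'.comp continuous_inl⟩

variable (A) in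
/-- The base point of `X/A` (the image of `A`; the disjoint point if `A = ∅`). [folklore] -/
def pt : Collapse X A := mk' A (Sum.inr ())

/-- `mk` in terms of `mk'`. [folklore] -/
theorem mk_apply (x : X) : mk A x = mk' A (Sum.inl x) := rfl

/-- The extra point maps to the base point. [folklore] -/
theorem mk'_inr (z : Unit) : mk' A (Sum.inr z) = pt A := rfl

/-- Points of `A` map to the base point. [folklore] -/
theorem mk_eq_pt {a : X} (ha : a ∈ A) : mk A a = pt A :=
  mk'_eq_mk'_iff.2 (by rw [collapseKey_inl_of_mem ha, collapseKey_inr])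

/-- `mk x` is the base point iff `x ∈ A`. [folklore] -/
theorem mk_eq_pt_iff {x : X} : mk A x = pt A ↔ x ∈ A := by
  rw [mk_apply, pt, mk'_eq_mk'_iff, collapseKey_inr]
  by_cases hx : x ∈ A
  · simp [collapseKey_inl_of_mem hx, hx]
  · simp [collapseKey_inl_of_not_mem hx, hx]

/-- `mk x = mk y` iff `x = y` or both lie in `A`. [folklore] -/
theorem mk_eq_mk_iff {x y : X} : mk A x = mk A y ↔ x = y ∨ (x ∈ A ∧ y ∈ A) := by
  rw [mk_apply, mk_apply, mk'_eq_mk'_iff]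
  by_cases hx : x ∈ A <;> by_cases hy : y ∈ A
  · simp [collapseKey_inl_of_mem hx, collapseKey_inl_of_mem hy, hx, hy]
  · simp only [collapseKey_inl_of_mem hx, collapseKey_inl_of_not_mem hy, hx, hy, and_false, or_false,
      reduceCtorEq, false_iff]
    rintro rfl; exact hy hx
  · simp only [collapseKey_inl_of_not_mem hx, collapseKey_inl_of_mem hy, hx, hy, false_and, or_false,
      reduceCtorEq, false_iff]
    rintro rfl; exact hx hy
  · simp [collapseKey_inl_of_not_mem hx, collapseKey_inl_of_not_mem hy, hx]

/-- `mk` is injective off `A`. [folklore] -/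
theorem mk_injOn : InjOn (mk A) (↑A)ᶜ := fun x hx y _ h ↦ by
  rcases mk_eq_mk_iff.1 h with rfl | ⟨hx', -⟩
  · rfl
  · exact absurd hx' hx

/-- Every point of `X/A` is the base point or the image of a point outside `A`. [folklore] -/
theorem eq_pt_or_eq_mk (z : Collapse X A) : z = pt A ∨ ∃ x ∉ A, z = mk A x := by
  obtain ⟨w, rfl⟩ := mk'_surjective z
  rcases w with x | ⟨⟨⟩⟩
  · by_cases hx : x ∈ A
    · exact Or.inl (mk_eq_pt hx)
    · exact Or.inr ⟨x, hx, rfl⟩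
  · exact Or.inl rfl

/-- Induction principle for `X/A`. [folklore] -/
theorem forall_iff {P : Collapse X A → Prop} : (∀ z, P z) ↔ P (pt A) ∧ ∀ x, P (mk A x) := by
  refine ⟨fun h ↦ ⟨h _, fun x ↦ h _⟩, fun ⟨h₁, h₂⟩ z ↦ ?_⟩
  rcases eq_pt_or_eq_mk z with rfl | ⟨x, -, rfl⟩
  exacts [h₁, h₂ x]

/-! ### Universal property -/

section lift

variable {Y : Type v} [TopologicalSpace Y]

omit [TopologicalSpace Y] in
/-- A map constant on `A` is compatible with the collapse relation. [folklore] -/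
theorem sumElim_congr (f : X → Y) (y : Y) (hf : ∀ a ∈ A, f a = y) {z w : X ⊕ Unit}
    (h : collapseKey A z = collapseKey A w) : Sum.elim f (fun _ ↦ y) z = Sum.elim f (fun _ ↦ y) w := by
  rcases z with x | ⟨⟨⟩⟩ <;> rcases w with x' | ⟨⟨⟩⟩
  · by_cases hx : x ∈ A <;> by_cases hx' : x' ∈ A
    · simp [hf x hx, hf x' hx']
    · rw [collapseKey_inl_of_mem hx, collapseKey_inl_of_not_mem hx'] at h; exact absurd h (by simp)
    · rw [collapseKey_inl_of_not_mem hx, collapseKey_inl_of_mem hx'] at h; exact absurd h (by simp)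
    · rw [collapseKey_inl_of_not_mem hx, collapseKey_inl_of_not_mem hx'] at h
      simp only [Option.some.injEq] at h
      simp [h]
  · by_cases hx : x ∈ A
    · simp [hf x hx]
    · rw [collapseKey_inl_of_not_mem hx, collapseKey_inr] at h; exact absurd h (by simp)
  · by_cases hx' : x' ∈ A
    · simp [hf x' hx']
    · rw [collapseKey_inl_of_not_mem hx', collapseKey_inr] at h; exact absurd h (by simp)
  · rfl

/-- **Universal property**: a continuous map constant on `A`, with that constant prescribed as
the value at the base point, descends to `X/A`. [folklore] -/
def lift (f : C(X, Y)) (y : Y) (hf : ∀ a ∈ A, f a = y) : C(Collapse X A, Y) where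
  toFun := Quotient.lift (Sum.elim f fun _ ↦ y) fun _ _ h ↦ sumElim_congr f y hf h
  continuous_toFun := Continuous.quotient_lift (by fun_prop) _

/-- `lift f y hf ∘ mk = f`. [folklore] -/
@[simp] theorem lift_mk (f : C(X, Y)) (y : Y) (hf : ∀ a ∈ A, f a = y) (x : X) :
    lift f y hf (mk A x) = f x := rfl

/-- `lift f y hf pt = y`. [folklore] -/
@[simp] theorem lift_pt (f : C(X, Y)) (y : Y) (hf : ∀ a ∈ A, f a = y) : lift f y hf (pt A) = y := rfl

/-- `lift f y hf ∘ mk = f` as continuous maps. [folklore] -/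
theorem lift_comp_mk (f : C(X, Y)) (y : Y) (hf : ∀ a ∈ A, f a = y) : (lift f y hf).comp (mk A) = f :=
  ContinuousMap.ext fun _ ↦ rfl

/-- Maps out of `X/A` are determined by their composite with `mk` and their value at `pt`.
[folklore] -/
theorem hom_ext {g₁ g₂ : C(Collapse X A, Y)} (h : ∀ x, g₁ (mk A x) = g₂ (mk A x))
    (hpt : g₁ (pt A) = g₂ (pt A)) : g₁ = g₂ :=
  ContinuousMap.ext (forall_iff.2 ⟨hpt, h⟩)

/-- If `A` is nonempty the value at `pt` is forced. [folklore] -/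
theorem hom_ext_of_nonempty (hA : (A : Set X).Nonempty) {g₁ g₂ : C(Collapse X A, Y)}
    (h : ∀ x, g₁ (mk A x) = g₂ (mk A x)) : g₁ = g₂ := by
  obtain ⟨a, ha⟩ := hA
  exact hom_ext h (by rw [← mk_eq_pt ha]; exact h a)

end lift

/-! ### Functoriality -/

section map

variable {Y : Type v} [TopologicalSpace Y] {B : Closeds Y}

/-- A map of pairs `(X, A) → (Y, B)` induces `X/A → Y/B`. [folklore] -/
def map (f : C(X, Y)) (hf : MapsTo f A B) : C(Collapse X A, Collapse Y B) :=
  lift ((mk B).comp f) (pt B) fun _ ha ↦ mk_eq_pt (hf ha)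

/-- `map f ∘ mk = mk ∘ f`. [folklore] -/
@[simp] theorem map_mk (f : C(X, Y)) (hf : MapsTo f A B) (x : X) : map f hf (mk A x) = mk B (f x) := rfl

/-- `map f` preserves base points. [folklore] -/
@[simp] theorem map_pt (f : C(X, Y)) (hf : MapsTo f A B) : map f hf (pt A) = pt B := rfl

end map

/-- `map id = id`. [folklore] -/
theorem map_id : map (ContinuousMap.id X) (mapsTo_id (A : Set X)) = ContinuousMap.id (Collapse X A) :=
  hom_ext (fun _ ↦ rfl) rfl

/-- `map (g ∘ f) = map g ∘ map f`. [folklore] -/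
theorem map_comp {Y : Type v} [TopologicalSpace Y] {B : Closeds Y} {Z : Type*} [TopologicalSpace Z]
    {C : Closeds Z} (f : C(X, Y)) (hf : MapsTo f A B) (g : C(Y, Z)) (hg : MapsTo g B C) :
    map (g.comp f) (hg.comp hf) = (map g hg).comp (map f hf) :=
  hom_ext (fun _ ↦ rfl) rfl

/-! ### Compactness and the Hausdorff property -/

/-- `X/A` is compact for compact `X`. -/
instance [CompactSpace X] : CompactSpace (Collapse X A) :=
  inferInstanceAs (CompactSpace (Quotient _))

/-- `X/A` is nonempty (it has a base point). -/
instance : Nonempty (Collapse X A) := ⟨pt A⟩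

/-- Images of open sets missing `A` are open in `X/A`. [folklore] -/
theorem isOpen_image_mk {U : Set X} (hU : IsOpen U) (hUA : Disjoint U A) : IsOpen (mk A '' U) := by
  rw [← isQuotientMap_mk'.isOpen_preimage]
  have : mk' A ⁻¹' (mk A '' U) = Sum.inl '' U := by
    ext (x | ⟨⟨⟩⟩)
    · simp only [mem_preimage, mem_image, Sum.inl.injEq, exists_eq_right]
      constructor
      · rintro ⟨x', hx', h⟩
        rcases mk_eq_mk_iff.1 h with rfl | ⟨hx'A, -⟩
        · exact hx'
        · exact absurd hx'A (hUA.notMem_of_mem_left hx')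
      · exact fun hx ↦ ⟨x, hx, rfl⟩
    · simp only [mem_preimage, mem_image, reduceCtorEq, and_false, exists_false, iff_false, mk'_inr]
      rintro ⟨x', hx', h⟩
      exact hUA.notMem_of_mem_left hx' (mk_eq_pt_iff.1 h)
  rw [this]
  exact isOpenMap_inl _ hU

/-- Images of open neighbourhoods of `A`, together with the base point, are open in `X/A`.
[folklore] -/
theorem isOpen_insert_image_mk {V : Set X} (hV : IsOpen V) (hAV : (A : Set X) ⊆ V) :
    IsOpen (insert (pt A) (mk A '' V)) := by
  rw [← isQuotientMap_mk'.isOpen_preimage]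
  have : mk' A ⁻¹' (insert (pt A) (mk A '' V)) = Sum.inl '' V ∪ range Sum.inr := by
    ext (x | ⟨⟨⟩⟩)
    · simp only [mem_preimage, mem_insert_iff, mem_image, mem_union, Sum.inl.injEq, exists_eq_right,
        mem_range, reduceCtorEq, exists_false, or_false]
      constructor
      · rintro (h | ⟨x', hx', h⟩)
        · exact hAV (mk_eq_pt_iff.1 h)
        · rcases mk_eq_mk_iff.1 h with rfl | ⟨-, hxA⟩
          · exact hx'
          · exact hAV hxA
      · exact fun hx ↦ Or.inr ⟨x, hx, rfl⟩
    · simp [mk'_inr]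
  rw [this]
  exact (isOpenMap_inl _ hV).union isOpen_range_inr

/-- **`X/A` is Hausdorff** for closed `A` in a regular Hausdorff space (e.g. compact Hausdorff).
[folklore] -/
instance [T2Space X] [RegularSpace X] : T2Space (Collapse X A) := by
  rw [t2Space_iff]
  -- separate `pt` from `mk x`, `x ∉ A`
  have key : ∀ x ∉ A, ∃ u v : Set (Collapse X A), IsOpen u ∧ IsOpen v ∧ pt A ∈ u ∧ mk A x ∈ v ∧ Disjoint u v := by
    intro x hx
    have hx' : x ∉ closure (A : Set X) := by rwa [A.isClosed.closure_eq]
    have hd : Disjoint (𝓝ˢ (A : Set X)) (𝓝 x) := disjoint_nhdsSet_nhds.2 hx'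
    rcases (hasBasis_nhdsSet (A : Set X)).disjoint_iff (nhds_basis_opens x) |>.1 hd with
      ⟨V, ⟨hV, hAV⟩, U, ⟨hxU, hU⟩, hVU⟩
    refine ⟨_, _, isOpen_insert_image_mk hV hAV, isOpen_image_mk hU ?_, mem_insert _ _, ⟨x, hxU, rfl⟩, ?_⟩
    · exact Set.disjoint_of_subset_right hAV hVU.symm
    · rw [Set.disjoint_iff]
      rintro z ⟨hz₁ | ⟨v, hv, rfl⟩, ⟨u', hu', hzu⟩⟩
      · exact (Set.disjoint_of_subset_right hAV hVU.symm).notMem_of_mem_left hu' (mk_eq_pt_iff.1 (hzu.trans hz₁)) |>.elim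
      · rcases mk_eq_mk_iff.1 hzu with rfl | ⟨hu'A, -⟩
        · exact (Set.disjoint_iff.1 hVU ⟨hv, hu'⟩).elim
        · exact ((Set.disjoint_of_subset_right hAV hVU.symm).notMem_of_mem_left hu' hu'A).elim
  intro z w hzw
  rcases eq_pt_or_eq_mk z with rfl | ⟨x, hx, rfl⟩ <;> rcases eq_pt_or_eq_mk w with rfl | ⟨y, hy, rfl⟩
  · exact absurd rfl hzw
  · exact key y hy
  · obtain ⟨u, v, hu, hv, hpu, hxv, huv⟩ := key x hx
    exact ⟨v, u, hv, hu, hxv, hpu, huv.symm⟩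
  · have hxy : x ≠ y := fun h ↦ hzw (h ▸ rfl)
    obtain ⟨O, O', hO, hO', hxO, hyO', hOO'⟩ := t2_separation hxy
    refine ⟨mk A '' (O ∩ (↑A)ᶜ), mk A '' (O' ∩ (↑A)ᶜ), isOpen_image_mk (hO.inter A.isClosed.isOpen_compl) ?_,
      isOpen_image_mk (hO'.inter A.isClosed.isOpen_compl) ?_, ⟨x, ⟨hxO, hx⟩, rfl⟩, ⟨y, ⟨hyO', hy⟩, rfl⟩, ?_⟩
    · exact disjoint_compl_left.mono_left inter_subset_right
    · exact disjoint_compl_left.mono_left inter_subset_right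
    · rw [Set.disjoint_iff]
      rintro _ ⟨⟨a, ⟨haO, haA⟩, rfl⟩, ⟨b, ⟨hbO', hbA⟩, hba⟩⟩
      rcases mk_eq_mk_iff.1 hba with rfl | ⟨hbA', -⟩
      · exact Set.disjoint_iff.1 hOO' ⟨haO, hbO'⟩
      · exact hbA hbA'

end Collapse

end Literature.AlgebraicTopology.KTheory

end
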